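import Summits.ResolutionOfSingularities.ResolutionOfSingularities.Theorems.FrobeniusClosingPatchingRelPerfectThreeLetterStepPairs
import Summits.ResolutionOfSingularities.ResolutionOfSingularities.Theorems.FrobeniusClosingPatchingRelPerfectCoreRungTowerCharts
import Summits.ResolutionOfSingularities.ResolutionOfSingularities.Theorems.FrobeniusClosingPatchingRelPerfectPointBlowupChartAssembly
import Summits.ResolutionOfSingularities.ResolutionOfSingularities.Theorems.FrobeniusClosingPatchingRelPerfectCoreRungSquarePlusLinearCharts
import HarnessLib

/-!
# Crux `PatchingRelPerfect` (stmt-ResolutionOfSingularities-16161), chain w52 — rung toolkit: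
# the THREE-LETTER TOWER is regular (every schedule word, arbitrary regular domain)

[OURS · L1 W5.2 · rung tool] The composition device of the contact-migration member's
certificate (this seat's HAND-NOTE-nongraded-A2.md §4, PLAN-A2-certificate.md O3).  Data: a regular
domain `R`, a "hyperplane" `c` and two "letters" `ℓ`, `o` with the (symmetric, pair-type)
hypotheses `H'(R; c, ℓ, o)` — `(c,ℓ)`, `(c,o)` quasi-regular with regular integral quotients, `R/(c)`
regular, `ℓ`, `o` regular modulo `c`, `R/(c,ℓ,o)` a domain, `o ∉ (c,ℓ)`, `ℓ ∉ (c,o)` — and a schedule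
word `w : ℕ → Bool` (`true` = blow up `V(c, ℓ)`, `false` = blow up `V(c, o)`, then continue with the
strict transform `c'` of `c` on the letter's chart).  The `N`-step schedule is ONE blowing up, along
the flag product

  `TL_N(w) = ∏_{s<N} (c, λ_{w 0} λ_{w 1} ⋯ λ_{w s})`,  `λ_true = ℓ`, `λ_false = o`

(`N = 2`, `w = (ℓ,ℓ)`: `(c,ℓ)(c,ℓ²)`; the A₂ member's schedule `(ℓ,ℓ,o,ℓ,o)`:
`(c,ℓ)(c,ℓ²)(c,ℓ²o)(c,ℓ³o)(c,ℓ³o²)`).  PROVED: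

* `isRegular_of_isBlowup_threeLetterTower` — **every blowing up of `Spec R` along `TL_N(w)` is a
  regular scheme**, by induction on `N`: `TL_{N+1}(w) = TL'·(c, λ_{w 0})`; blow up `V(c, λ_{w 0})`
  (chartwise assembly, Stacks 080A); on the `c`-chart the tail is the Cartier divisor `(c̄ᴺ)`
  (`map_threeLetterTail_eq_span_pow`), on the letter's chart it is `(λ̄ᴺ) · TL_N(w ∘ succ)` in the
  letters `(c', ℓ', o')` (`map_threeLetterTail`), and `H'` reproduces itself there (the step files
  `…ThreeLetterStep`, `…ThreeLetterStepPairs`); the case `w 0 = false` is the case `true` for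
  `(c, o, ℓ, ¬w)` (`threeLetterTower_swap`).

Arbitrary regular domains; no dimension, characteristic or completeness hypothesis.  FORMAT evidence
for the core stub only; nothing here is a statement of the manuscript under review.

## References

* The Stacks Project, Tags 080A, 080B, 0804, 0BIQ. [StacksProject]
* Q. Liu, *Algebraic Geometry and Arithmetic Curves*, OUP 2002, Thm. 8.1.19 (a). [Liu2002]
* U. Görtz, T. Wedhorn, *Algebraic Geometry I*, 2nd ed. 2020, Prop. 13.91 (2), 13.96 (2), (13.19). [GortzWedhorn2020]
-/

-- `Summit.<Summit>.<Sub>.Theorems` with `Sub = Summit` (single-conjunct summit, D-0017)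
set_option linter.dupNamespace false

noncomputable section

open CategoryTheory CategoryTheory.Limits AlgebraicGeometry Literature.AlgebraicGeometry.Resolution
open IsLocalRing

namespace Summit.ResolutionOfSingularities.ResolutionOfSingularities.Theorems

namespace ConeRung

universe u

/-! ## Ideal algebra of the flag product (any commutative rings) -/

section Algebra

variable {R B : Type*} [CommRing R] [CommRing B]

/-- `(a b, m a) = (a) · (b, m)`. [folklore] -/
theorem span_pair_mul_eq (a b m : B) :
    Ideal.span {a * b, m * a} = Ideal.span {a} * Ideal.span {b, m} := by
  rw [mul_comm m a, Ideal.span_insert, Ideal.span_insert, Ideal.mul_sup,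
    Ideal.span_singleton_mul_span_singleton, Ideal.span_singleton_mul_span_singleton]

/-- `(a, m (a g)) = (a)`. [folklore] -/
theorem span_pair_eq_of_mul (a g m : B) : Ideal.span {a, m * (a * g)} = Ideal.span {a} := by
  rw [Ideal.span_insert, sup_eq_left]
  exact Ideal.span_singleton_le_span_singleton.mpr ⟨m * g, by ring⟩

/-- **The flag product one step up**: `TL_{N+1}(w) = (∏_{s<N} (c, λ_{w 0} ⋯ λ_{w (s+1)})) · (c, λ_{w 0})`.
[folklore] -/
theorem threeLetterTower_succ (c ℓ o : R) (w : ℕ → Bool) (N : ℕ) :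
    ∏ s ∈ Finset.range (N + 1),
        Ideal.span {c, ∏ r ∈ Finset.range (s + 1), bif w r then ℓ else o} =
      (∏ s ∈ Finset.range N,
        Ideal.span {c, ∏ r ∈ Finset.range (s + 2), bif w r then ℓ else o}) *
        Ideal.span {c, bif w 0 then ℓ else o} := by
  rw [Finset.prod_range_succ', Finset.prod_range_one]

/-- **Letter symmetry**: the flag product of `(c, ℓ, o, w)` is that of `(c, o, ℓ, ¬w)`. [folklore] -/
theorem threeLetterTower_swap (c ℓ o : R) (w : ℕ → Bool) (N : ℕ) :
    ∏ s ∈ Finset.range N,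
        Ideal.span {c, ∏ r ∈ Finset.range (s + 1), bif w r then ℓ else o} =
      ∏ s ∈ Finset.range N,
        Ideal.span {c, ∏ r ∈ Finset.range (s + 1), bif (!w r) then o else ℓ} := by
  simp_rw [Bool.cond_not]

/-- **The tail on the letter's chart**: if `ψ c = l c'`, `ψ ℓ = l` and `w 0 = true`, then
`ψ(∏_{s<N} (c, λ_{w 0} ⋯ λ_{w (s+1)})) = (lᴺ) · TL_N(w ∘ succ)` in the letters `(c', l, ψ o)`.
[cite: StacksProject, Tag 080B] -/
theorem map_threeLetterTail (ψ : R →+* B) (c ℓ o : R) (w : ℕ → Bool) (hw0 : w 0 = true)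
    (l c' : B) (hc : ψ c = l * c') (hl : ψ ℓ = l) (N : ℕ) :
    (∏ s ∈ Finset.range N,
        Ideal.span {c, ∏ r ∈ Finset.range (s + 2), bif w r then ℓ else o}).map ψ =
      Ideal.span {l ^ N} * ∏ s ∈ Finset.range N,
        Ideal.span {c', ∏ r ∈ Finset.range (s + 1), bif w (r + 1) then l else ψ o} := by
  rw [CoreRungTower.map_prod_range]
  have hfac : ∀ s : ℕ, (Ideal.span {c, ∏ r ∈ Finset.range (s + 2), bif w r then ℓ else o}).map ψ =
      Ideal.span {l} *
        Ideal.span {c', ∏ r ∈ Finset.range (s + 1), bif w (r + 1) then l else ψ o} := fun s => by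
    rw [Ideal.map_span, Set.image_pair, hc, map_prod, Finset.prod_range_succ', hw0]
    simp_rw [Bool.apply_cond ψ, hl, Bool.cond_true]
    exact span_pair_mul_eq l c' _
  simp_rw [hfac]
  rw [Finset.prod_mul_distrib, Finset.prod_const, Finset.card_range, Ideal.span_singleton_pow]

/-- **The tail on the `c`-chart**: if `ψ c = a`, `ψ ℓ = a g` and `w 0 = true`, then
`ψ(∏_{s<N} (c, λ_{w 0} ⋯ λ_{w (s+1)})) = (aᴺ)` (a Cartier divisor). [cite: StacksProject, Tag 080B] -/
theorem map_threeLetterTail_eq_span_pow (ψ : R →+* B) (c ℓ o : R) (w : ℕ → Bool)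
    (hw0 : w 0 = true) (a g : B) (hc : ψ c = a) (hl : ψ ℓ = a * g) (N : ℕ) :
    (∏ s ∈ Finset.range N,
        Ideal.span {c, ∏ r ∈ Finset.range (s + 2), bif w r then ℓ else o}).map ψ =
      Ideal.span {a ^ N} := by
  rw [CoreRungTower.map_prod_range]
  have hfac : ∀ s : ℕ, (Ideal.span {c, ∏ r ∈ Finset.range (s + 2), bif w r then ℓ else o}).map ψ =
      Ideal.span {a} := fun s => by
    rw [Ideal.map_span, Set.image_pair, hc, map_prod, Finset.prod_range_succ', hw0]
    simp_rw [Bool.apply_cond ψ, hl, Bool.cond_true]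
    exact span_pair_eq_of_mul a g _
  simp_rw [hfac]
  rw [Finset.prod_const, Finset.card_range, Ideal.span_singleton_pow]

/-- `(c, ℓ) + (o) = (c, o) + (ℓ)`. [folklore] -/
theorem span_pair_sup_comm (c ℓ o : R) :
    Ideal.span {c, ℓ} ⊔ Ideal.span {o} = Ideal.span {c, o} ⊔ Ideal.span {ℓ} := by
  rw [Ideal.span_insert, Ideal.span_insert, sup_assoc, sup_assoc, sup_comm (Ideal.span {ℓ})]

end Algebra

/-! ## The tower theorem -/

/-- **The three-letter tower is regular.**  For a regular domain `R` and `c, ℓ, o ∈ R` with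
`H'(R; c, ℓ, o)` (see the module docstring) and ANY schedule word `w`, every blowing up of `Spec R`
along the flag product `TL_N(w) = ∏_{s<N} (c, λ_{w 0} ⋯ λ_{w s})` is a regular scheme.  Induction on
`N` over all such data: blow up `V(c, λ_{w 0})` (chartwise assembly); the `c`-chart carries a Cartier
tail, the letter's chart the tower `TL_N(w ∘ succ)` for `(c', ℓ', o')`, where `H'` holds again
(`step_*`, `stepP_*`). [cite: StacksProject, Tag 080A] [cite: StacksProject, Tag 080B]
[cite: Liu2002, Thm. 8.1.19 (a)] [cite: GortzWedhorn2020, Prop. 13.96 (2)] -/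
theorem isRegular_of_isBlowup_threeLetterTower (N : ℕ) :
    ∀ {R : Type u} [CommRing R] [IsRegularRing R] [IsDomain R] (c ℓ o : R) (w : ℕ → Bool),
      IsQuasiRegular (Fin.cons c (fun _ : Fin 1 => ℓ) : Fin 2 → R) →
      IsQuasiRegular (Fin.cons c (fun _ : Fin 1 => o) : Fin 2 → R) →
      IsDomain (R ⧸ Ideal.span {c, ℓ}) → IsRegularRing (R ⧸ Ideal.span {c, ℓ}) →
      IsDomain (R ⧸ Ideal.span {c, o}) → IsRegularRing (R ⧸ Ideal.span {c, o}) →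
      IsRegularRing (R ⧸ Ideal.span {c}) →
      IsSMulRegular (R ⧸ Ideal.span {c}) ℓ → IsSMulRegular (R ⧸ Ideal.span {c}) o →
      IsDomain (R ⧸ (Ideal.span {c, ℓ} ⊔ Ideal.span {o})) →
      ℓ ≠ 0 → o ∉ Ideal.span {c, ℓ} → ℓ ∉ Ideal.span {c, o} →
      ∀ {Y : Scheme.{u}} {f : Y ⟶ Spec (.of R)},
        IsBlowup f (affineBlowup.idealSheaf (∏ s ∈ Finset.range N,
          Ideal.span {c, ∏ r ∈ Finset.range (s + 1), bif w r then ℓ else o})) →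
        Scheme.IsRegular Y := by
  induction N with
  | zero =>
    intro R _ _ _ c ℓ o w _ _ _ _ _ _ _ _ _ _ _ _ _ Y f hf
    rw [Finset.prod_range_zero, Ideal.one_eq_top, affineBlowup.idealSheaf_top] at hf
    haveI : IsIso f := hf.isIso isEffectiveCartier_top
    haveI : IsRegularRing (CommRingCat.of R) := inferInstanceAs (IsRegularRing R)
    exact SectionAscent.TraceIdeal.isRegular_of_iso (asIso f) (Scheme.isRegular_Spec _)
  | succ N ih =>
    -- the case `w 0 = true` (blow up `V(c, ℓ)` first), for all data
    have key : ∀ {R : Type u} [CommRing R] [IsRegularRing R] [IsDomain R] (c ℓ o : R)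
        (w : ℕ → Bool), w 0 = true →
        IsQuasiRegular (Fin.cons c (fun _ : Fin 1 => ℓ) : Fin 2 → R) →
        IsDomain (R ⧸ Ideal.span {c, ℓ}) → IsRegularRing (R ⧸ Ideal.span {c, ℓ}) →
        IsDomain (R ⧸ Ideal.span {c, o}) → IsRegularRing (R ⧸ Ideal.span {c, o}) →
        IsRegularRing (R ⧸ Ideal.span {c}) →
        IsSMulRegular (R ⧸ Ideal.span {c}) ℓ → IsSMulRegular (R ⧸ Ideal.span {c}) o →
        IsDomain (R ⧸ (Ideal.span {c, ℓ} ⊔ Ideal.span {o})) →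
        ℓ ≠ 0 → o ∉ Ideal.span {c, ℓ} → ℓ ∉ Ideal.span {c, o} →
        ∀ {Y : Scheme.{u}} {f : Y ⟶ Spec (.of R)},
          IsBlowup f (affineBlowup.idealSheaf (∏ s ∈ Finset.range (N + 1),
            Ideal.span {c, ∏ r ∈ Finset.range (s + 1), bif w r then ℓ else o})) →
          Scheme.IsRegular Y := by
      intro R _ _ _ c ℓ o w hw0 hcl hDl hRl hDo hRo hRc hℓc hoc hT hℓ0 ho hℓ Y f hf
      haveI := hDl; haveI := hRl; haveI := hDo; haveI := hRo; haveI := hRc; haveI := hT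
      haveI : IsRegularRing (R ⧸ Ideal.span (Set.range (Fin.cons c (fun _ : Fin 1 => ℓ) :
          Fin 2 → R))) := IsRegularRing.of_ringEquiv (Ideal.quotEquivOfEq (step_span_pair_eq c ℓ))
      rw [threeLetterTower_succ c ℓ o w N, hw0, Bool.cond_true, step_span_pair_eq c ℓ] at hf
      -- the `c`-chart: the tail is the Cartier divisor `(c̄ᴺ)`
      have h0 : ∀ (Y' : Scheme.{u})
          (ρ : Y' ⟶ Spec (.of (chartRing (Fin.cons c (fun _ : Fin 1 => ℓ) : Fin 2 → R) 0))),
          IsBlowup ρ (affineBlowup.idealSheaf ((∏ s ∈ Finset.range N,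
            Ideal.span {c, ∏ r ∈ Finset.range (s + 2), bif w r then ℓ else o}).map
              (chartBase (Fin.cons c (fun _ : Fin 1 => ℓ) : Fin 2 → R) 0))) →
            Scheme.IsRegular Y' := by
        intro Y' ρ hρ
        haveI : IsRegularRing (chartRing (Fin.cons c (fun _ : Fin 1 => ℓ) : Fin 2 → R) 0) :=
          isRegularRing_blowupChart _ 0 hcl
        have hc0 : chartBase (Fin.cons c (fun _ : Fin 1 => ℓ) : Fin 2 → R) 0 c ∈
            nonZeroDivisors _ :=
          reesChartBase_mem_nonZeroDivisors ((Fin.cons c (fun _ : Fin 1 => ℓ) : Fin 2 → R) 0)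
            (Ideal.mem_span_range_self (f := (Fin.cons c (fun _ : Fin 1 => ℓ) : Fin 2 → R))
              (x := 0))
        rw [map_threeLetterTail_eq_span_pow (chartBase (Fin.cons c (fun _ : Fin 1 => ℓ) :
            Fin 2 → R) 0) c ℓ o w hw0 _ _ rfl
          (reesChartBase_apply_eq_mul_chartGen (Fin.cons c (fun _ : Fin 1 => ℓ) : Fin 2 → R) 0
            (Fin.succ 0)) N] at hρ
        exact isRegular_of_isBlowup_idealSheaf_span_singleton_of_isRegularRing (pow_mem hc0 N) hρ
      -- the `ℓ`-chart: the tail is `(ℓ'ᴺ) · TL_N(w ∘ succ)` for `(c', ℓ', o')`, and `H'` again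
      have h1 : ∀ (Y' : Scheme.{u})
          (ρ : Y' ⟶ Spec (.of (chartRing (Fin.cons c (fun _ : Fin 1 => ℓ) : Fin 2 → R)
            (Fin.succ 0)))),
          IsBlowup ρ (affineBlowup.idealSheaf ((∏ s ∈ Finset.range N,
            Ideal.span {c, ∏ r ∈ Finset.range (s + 2), bif w r then ℓ else o}).map
              (chartBase (Fin.cons c (fun _ : Fin 1 => ℓ) : Fin 2 → R) (Fin.succ 0)))) →
            Scheme.IsRegular Y' := by
        intro Y' ρ hρ
        haveI : IsRegularRing (chartRing (Fin.cons c (fun _ : Fin 1 => ℓ) : Fin 2 → R)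
          (Fin.succ 0)) := step_isRegularRing c ℓ hcl
        haveI : IsDomain (chartRing (Fin.cons c (fun _ : Fin 1 => ℓ) : Fin 2 → R)
          (Fin.succ 0)) := step_isDomain c ℓ hℓ0
        have hl : chartBase (Fin.cons c (fun _ : Fin 1 => ℓ) : Fin 2 → R) (Fin.succ 0) ℓ ∈
            nonZeroDivisors _ :=
          reesChartBase_mem_nonZeroDivisors
            ((Fin.cons c (fun _ : Fin 1 => ℓ) : Fin 2 → R) (Fin.succ 0))
            (Ideal.mem_span_range_self (f := (Fin.cons c (fun _ : Fin 1 => ℓ) : Fin 2 → R))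
              (x := Fin.succ 0))
        rw [map_threeLetterTail (chartBase (Fin.cons c (fun _ : Fin 1 => ℓ) : Fin 2 → R)
            (Fin.succ 0)) c ℓ o w hw0 _ _
          (reesChartBase_apply_eq_mul_chartGen (Fin.cons c (fun _ : Fin 1 => ℓ) : Fin 2 → R)
            (Fin.succ 0) 0) rfl N] at hρ
        have ho' := step_o'_notMem c ℓ o hcl ho
        exact CoreRungTower.isRegular_of_isBlowup_span_singleton_mul (pow_mem hl N) _
          (fun Y'' ρ' hρ' => ih _ _ _ (fun r => w (r + 1))
            (stepP_isQuasiRegular_c'ℓ' c ℓ hcl hℓ0)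
            (stepP_isQuasiRegular_c'o' c ℓ o hcl hℓ0 hℓc hoc)
            (step_isDomain_quot_c'ℓ' c ℓ hcl) (step_isRegularRing_quot_c'ℓ' c ℓ hcl)
            (stepP_isDomain_quot_c'o' c ℓ o hcl hℓc) (stepP_isRegularRing_quot_c'o' c ℓ o hcl hℓc)
            (stepP_isRegularRing_quot_c' c ℓ hcl hℓc)
            (stepP_isSMulRegular_ℓ' c ℓ hcl hℓ0) (stepP_isSMulRegular_o' c ℓ o hcl hℓc hoc)
            (step_isDomain_quot_triple c ℓ o hcl)
            (nonZeroDivisors.ne_zero hl) ho' (stepP_ℓ'_notMem c ℓ o hcl hℓc hℓ) hρ') hρ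
      exact isRegular_of_isBlowup_mul_of_charts (Fin.cons c (fun _ : Fin 1 => ℓ) : Fin 2 → R) _
        (fun i => Fin.cases (motive := fun i => ∀ (Y' : Scheme.{u})
          (ρ : Y' ⟶ Spec (.of (chartRing (Fin.cons c (fun _ : Fin 1 => ℓ) : Fin 2 → R) i))),
          IsBlowup ρ (affineBlowup.idealSheaf ((∏ s ∈ Finset.range N,
            Ideal.span {c, ∏ r ∈ Finset.range (s + 2), bif w r then ℓ else o}).map
              (chartBase (Fin.cons c (fun _ : Fin 1 => ℓ) : Fin 2 → R) i))) →
            Scheme.IsRegular Y') h0 (fun k => by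
              obtain rfl : k = 0 := Subsingleton.elim _ _
              exact h1) i) hf
    -- the general case: `w 0 = false` is the case `true` for `(c, o, ℓ, ¬w)`
    intro R _ _ _ c ℓ o w hcl hco hDl hRl hDo hRo hRc hℓc hoc hT hℓ0 ho hℓ Y f hf
    cases hw : w 0
    · have ho0 : o ≠ 0 := fun h => ho (h ▸ Ideal.zero_mem _)
      haveI := hT
      have hT' : IsDomain (R ⧸ (Ideal.span {c, o} ⊔ Ideal.span {ℓ})) :=
        MulEquiv.isDomain _ (Ideal.quotEquivOfEq (span_pair_sup_comm c ℓ o)).symm.toMulEquiv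
      rw [threeLetterTower_swap c ℓ o w (N + 1)] at hf
      exact key c o ℓ (fun r => !w r) (by simp only [hw, Bool.not_false]) hco hDo hRo hDl hRl hRc
        hoc hℓc hT' ho0 hℓ ho hf
    · exact key c ℓ o w hw hcl hDl hRl hDo hRo hRc hℓc hoc hT hℓ0 ho hℓ hf

end ConeRung

end Summit.ResolutionOfSingularities.ResolutionOfSingularities.Theorems

end
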